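import Summits.NavierStokesRegularity.NavierStokesRegularity.Theses.AdaptedFrequency
import Summits.NavierStokesRegularity.NavierStokesRegularity.Theses.RecurrentProfiles
import Summits.NavierStokesRegularity.NavierStokesRegularity.Theorems.AdaptedFrequencyAdaptedFrequencyConvergesOfTypeIAncientLiouville
import Summits.NavierStokesRegularity.NavierStokesRegularity.Theorems.RellichScarTypeIBlowupProfile
import Summits.NavierStokesRegularity.NavierStokesRegularity.Theorems.RecurrentProfilesRecurrentReduction
import Summits.NavierStokesRegularity.NavierStokesRegularity.Theorems.RecurrentProfilesTargetOfCruxes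
import HarnessLib

/-!
# Crux `AdaptedFrequencyConverges` (stmt-NavierStokesRegularity-10493), line `birkhoff-recurrent-hull`:
  the certificate `RecurrentLiouville (stmt-1589) ⟹ AdaptedFrequencyConverges`, with NO further stub

Helper file (`--supports` the crux item; lead prover-line-stmt-NavierStokesRegularity-10493-c4-0).

The strategist's line `birkhoff-recurrent-hull` (Cruxes/AdaptedFrequencyConverges/Lines/birkhoff_recurrent_hull.lean)
wires the crux to the EXISTING crux `Theses.RecurrentProfiles.RecurrentLiouville`
(stmt-NavierStokesRegularity-1589) through two soft stubs on the pinched mild hull (Birkhoff recurrence of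
pinched PAIRS, and a bridge from recurrent pinched pairs to Albritton–Barker's local-energy class). This
file records that BOTH soft steps are already theorems of the tree once they are taken BEFORE the hull
transfer instead of after it, i.e. on the blow-up itself rather than on its tangent pairs:

* `typeIBlowupProfile_recurrentProfiles` (item stmt-1591, PROVED; `…Theorems.RellichScarTypeIBlowupProfile`):
  a maximal classical Type-I blow-up from a rapidly decaying Leray–Hopf datum generates a local-energy
  Type-I-rate profile on `ℝ³ × ℝ₋`, singular at the origin — this is the bridge;
* `recurrentReduction_proof` (item stmt-1590, PROVED; `…Theorems.RecurrentProfilesRecurrentReduction`):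
  Birkhoff recurrence on that compact scaling-invariant class — an origin-singular profile yields a
  UNIFORMLY RECURRENT origin-singular profile;
* `recurrentProfiles_targetOfCruxes_proof` (stmt-1593, PROVED): the two-line glue
  `RecurrentLiouville → RecurrentReduction → NoTypeIRateProfile`;
* `adaptedFrequencyConverges_of_noTypeIBlowup` (p121598, `…OfTypeIAncientLiouville`): the route target
  `NoTypeIBlowup` implies the crux by vacuity (a continuation past `T` forbids a backward-singular point
  at time `T`).

Composition (pure logic, this file):
`RecurrentLiouville ⟹ NoTypeIRateProfile ⟹ NoTypeIBlowup ⟹ AdaptedFrequencyConverges`, the middle arrow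
because `IsMaximalSmoothSolution ν 0 u p T` is BY DEFINITION `IsClassicalNSSolutionOn (Ico 0 T) ν 0 u p ∧
¬ HasSmoothExtensionPast ν 0 u T`. Consequences recorded for the planners:

1. **`adaptedFrequencyConverges_of_recurrentLiouville : RecurrentLiouville → AdaptedFrequencyConverges`**
   — the crux is implied by the EXISTING open item stmt-1589 OUTRIGHT (no pinched-hull stub remains); the
   ledger state of stmt-10493 is `blocked-on: stmt-NavierStokesRegularity-1589` (previously parked on the
   stronger stmt-4050, certificate p121598).
2. **`noTypeIBlowup_of_noTypeIRateProfile : RecurrentProfiles.NoTypeIRateProfile → AdaptedFrequency.NoTypeIBlowup`**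
   — route level: the TARGET of route AdaptedFrequency (stmt-1217) is implied by the TARGET of route
   RecurrentProfiles (stmt-1588); with the proved `recurrentReduction_proof` both are implied by stmt-1589
   alone (`noTypeIBlowup_of_recurrentLiouville`).

Nothing here is new mathematics; it is the dependency edge the strategist's census asked a prover to land
(STRATEGY-CENSUS.md §4), in its strongest available form.
-/

noncomputable section

-- the summit and its single problem share the name (D-0017 nested layout)
set_option linter.dupNamespace false

namespace Summit.NavierStokesRegularity.NavierStokesRegularity.Theorems.AdaptedFrequencyConverges.BirkhoffRecurrentHull

open Summit.NavierStokesRegularity.NavierStokesRegularity.Theses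
open Literature.Analysis.FluidPDE Set

/-- **No Type-I-rate profile ⟹ no Type-I blow-up.** If no profile of the Albritton–Barker local-energy
Type-I-rate class is singular at the origin (`RecurrentProfiles.NoTypeIRateProfile`, stmt-1588), then every
classical Leray–Hopf solution from a rapidly decaying datum that blows up at most at the Type-I rate at `T`
continues classically past `T` (`AdaptedFrequency.NoTypeIBlowup`, stmt-1217). Proof: otherwise `(u, p)` is a
maximal smooth solution with lifespan `T` (definition of `IsMaximalSmoothSolution`), and the PROVED item
`TypeIBlowupProfile` (stmt-1591) produces an origin-singular class profile, which the hypothesis forbids.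
[cite: AlbrittonBarker2019, §3 (Type-I blow-up generates a local-energy profile)] -/
theorem noTypeIBlowup_of_noTypeIRateProfile :
    Summit.NavierStokesRegularity.NavierStokesRegularity.Theses.RecurrentProfiles.NoTypeIRateProfile →
      Summit.NavierStokesRegularity.NavierStokesRegularity.Theses.AdaptedFrequency.NoTypeIBlowup := by
  intro hT ν T hν hT' u p hcl hLH hdec hI
  by_contra hext
  have hmax : IsMaximalSmoothSolution ν 0 u p T := ⟨hcl, hext⟩
  obtain ⟨w, q, H, C, hsw, hgr, hIb, hdecay, hsing⟩ :=
    Summit.NavierStokesRegularity.NavierStokesRegularity.Theorems.typeIBlowupProfile_recurrentProfiles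
      ν T hν hT' u p hmax hLH hdec hI
  exact hT w q H C hsw hgr hIb hdecay hsing

/-- **Recurrent Liouville ⟹ no Type-I-rate profile**: the target of route RecurrentProfiles from its single
open crux, because the reduction to uniformly recurrent profiles (`RecurrentReduction`, stmt-1590) and the
glue `TargetOfCruxes` (stmt-1593) are PROVED in tree (`recurrentReduction_proof`,
`recurrentProfiles_targetOfCruxes_proof`). [cite: Furstenberg1981, Thm 1.17 (minimal sets consist of uniformly recurrent points)] -/
theorem noTypeIRateProfile_of_recurrentLiouville :
    RecurrentProfiles.RecurrentLiouville → RecurrentProfiles.NoTypeIRateProfile := fun hRL =>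
  Summit.NavierStokesRegularity.NavierStokesRegularity.Theorems.recurrentProfiles_targetOfCruxes_proof hRL
    Summit.NavierStokesRegularity.NavierStokesRegularity.Theorems.recurrentReduction_proof

/-- **Recurrent Liouville ⟹ no Type-I blow-up** (stmt-1589 ⟹ stmt-1217, the target of route
AdaptedFrequency). [cite: AlbrittonBarker2019, §3] -/
theorem noTypeIBlowup_of_recurrentLiouville :
    RecurrentProfiles.RecurrentLiouville → AdaptedFrequency.NoTypeIBlowup := fun hRL =>
  noTypeIBlowup_of_noTypeIRateProfile (noTypeIRateProfile_of_recurrentLiouville hRL)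

/-- **No Type-I-rate profile ⟹ the crux** (stmt-1588 ⟹ stmt-10493): through `NoTypeIBlowup` and the
vacuity certificate `adaptedFrequencyConverges_of_noTypeIBlowup` (a continuation past `T` forbids the
backward-singular point `(T, x₀)` the crux assumes). [folklore] -/
theorem adaptedFrequencyConverges_of_noTypeIRateProfile :
    RecurrentProfiles.NoTypeIRateProfile → AdaptedFrequency.AdaptedFrequencyConverges := fun h =>
  CloudFrameEffectiveTsai.adaptedFrequencyConverges_of_noTypeIBlowup (noTypeIBlowup_of_noTypeIRateProfile h)

/-- **THE CERTIFICATE of line `birkhoff-recurrent-hull`: `RecurrentLiouville` (stmt-NavierStokesRegularity-1589)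
⟹ `AdaptedFrequencyConverges` (stmt-NavierStokesRegularity-10493), with no further stub.** The recurrent
Liouville theorem for the local-energy Type-I-rate class kills, via the proved Birkhoff reduction
(stmt-1590) and the proved profile extraction (stmt-1591), every Type-I blow-up of a classical Leray–Hopf
solution from a rapidly decaying datum; the crux's hypotheses (such a blow-up WITH a backward-singular
point at the blow-up time) are then contradictory, so its conclusion (convergence of the adapted
frequency) holds. [cite: Furstenberg1981, Thm 1.17; AlbrittonBarker2019, §3] -/
theorem adaptedFrequencyConverges_of_recurrentLiouville :
    Summit.NavierStokesRegularity.NavierStokesRegularity.Theses.RecurrentProfiles.RecurrentLiouville →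
      Summit.NavierStokesRegularity.NavierStokesRegularity.Theses.AdaptedFrequency.AdaptedFrequencyConverges :=
  fun hRL =>
  CloudFrameEffectiveTsai.adaptedFrequencyConverges_of_noTypeIBlowup (noTypeIBlowup_of_recurrentLiouville hRL)

end Summit.NavierStokesRegularity.NavierStokesRegularity.Theorems.AdaptedFrequencyConverges.BirkhoffRecurrentHull

end
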